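import Summits.PneNP.PneNP.Theorems.ChebyshevTracialDesignGammaDirectionReduction
import HarnessLib

/-!
# Cell pnp-psdrank, route `ChebyshevTracialDesign`: the virtual-positivity criterion for the γ-direction IN THE CENTRED BASIS
# (crux `TracialDecayExp20`, stmt-PneNP-19878)

Brick 130 (prover g26; MEMO-28 §3c (i)–(iii) made formal, MEMO-29). Brick 129 reduced (CG_1′) for `H`-symmetric masks in every type-constant direction to
the sign of ONE virtual value `N^{odd}_D[Φ](0)`, `Φ(c) = E_{Shell_c(M)}[ψ(X)(2γ n_A + 2λX + κt)²]` (GENUINE level-`c` law of `(X, n_A)`). Fiberwise in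
`X`, `Φ(c) = Σ_x ψ(x)·Q_c(x)` with the nonnegative `x`-SECTIONS `Q_c(x) = E_c[1_{X=x}(2γ n_A + 2λx + κt)²]`, so brick 121's criterion applies verbatim:
`N^{odd}_D[Φ](0) ≥ −2^{D+1}G·(tail)` as soon as `Σ_{k=1}^D (C(2k,k)/4^k)|Δ^k Q_·(x)| ≤ Q_1(x)` on a window (`gammaProfile_newton_eval_zero_ge`). MEMO-28 §3
found that this pointwise criterion CANNOT be verified term by term in the basis `(n_A, 1)` (the `2×2` form has collinearity `1 − ρ² ≍ 1/n`), and §3c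
that CENTRING `n_A` at any fixed `m(x)` (the level-`1` conditional mean makes the cross term vanish at level `1`) removes the obstruction. This file
proves the corresponding ABSTRACT CRITERION and its shell instance:

* §1 **`sum_abs_fwdDiff_quadForm_le`**: for sequences `A, B, C` with `A₀, C₀ ≥ 0`, `B₀ = 0` and relative smoothness
  `Σ c_k|Δ^kA(0)| ≤ ε_A A₀`, `Σ c_k|Δ^kB(0)| ≤ ε_B √(A₀C₀)`, `Σ c_k|Δ^kC(0)| ≤ ε_C C₀` with `ε_A + ε_B ≤ 1`, `ε_C + ε_B ≤ 1`: the quadratic-form sequence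
  `Q = γ²A + 2γℓB + ℓ²C` satisfies `Σ c_k|Δ^kQ(0)| ≤ Q₀` for EVERY `γ, ℓ` (linearity + `2|γℓ|√(A₀C₀) ≤ γ²A₀ + ℓ²C₀`).
* §2 the `x`-sections: `gammaProfile_eq_sum_sections` (`Φ(c) = Σ_{x∈[0,t]} ψ(x)Q_c(x)`), `gammaSection_nonneg`, `gammaSection_le_law`
  (`Q_c(x) ≤ (2n+3t)²·law_c(x)` for `|γ|,|λ|,|κ| ≤ 1`), **`gammaSection_eq_centred`** (for ANY `m`: `Q_c(x) = (2γ)²A^m_c(x) + 2(2γ)ℓ_m(x)B^m_c(x) + ℓ_m(x)²law_c(x)`,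
  `A^m_c(x) = E_c[1_{X=x}(n_A − m)²]`, `B^m_c(x) = E_c[1_{X=x}(n_A − m)]`, `ℓ_m(x) = 2λx + κt + 2γm`).
* §3 **`gammaProfile_newton_eval_zero_ge`** (brick 121 on the sections) and **`gammaProfile_newton_eval_zero_ge_of_centred`** (THE CRITERION): if on a
  window `B ⊆ [0,t]`, for some centring `m(x)` with `B^m_1(x) = 0`, the three profiles `c ↦ A^m_c(x)`, `B^m_c(x)`, `law_c(x)` are relatively level-smooth to order
  `D` with `ε_A + ε_B ≤ 1`, `ε_C + ε_B ≤ 1`, then for every `0 ≤ ψ ≤ G` and EVERY `|γ|,|λ|,|κ| ≤ 1`: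
  `N^{odd}_D[Φ](0) ≥ −2^{D+1}·G·(2n+3t)²·Σ_{x∈[0,t]∖B} Σ_{j≤D} law_{2j+1}(x)` — the γ-direction main term is virtually nonnegative up to the law's tail
  mass, uniformly in the direction. The hypotheses are exactly MEMO-28 §3c (i)–(iii): (i) = the [BULK] relative smoothness of the law (bricks 124/125),
  (ii)/(iii) = relative smoothness of the centred second / first conditional-moment profiles of `n_A` given `X = x` (lit's `TrinomialLineSection` line).
WHAT THIS FILE DOES NOT DO: prove (ii)/(iii) (the centred-moment [BULK], next bricks), bound the law tail (Literature `ShellLawTail`), the assembly with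
brick 129's remainders, anything on `TracialDecayExp20` itself, psd rank of P_PM(K_n), or P vs NP.
[cite: Agarwal2000DifferenceEquations, Thm. 1.8.5 (1.8.6), Remark 1.8.1 (1.8.8)] [cite: Rivlin1974, Sect. 1.3 (1.32)–(1.34)]
[cite: Rothvoss2017, §2 (PDF p. 6)]
Stature: support/instrument (kernel lane, no defs, axioms standard). Supports stmt-PneNP-19878.
-/

set_option linter.dupNamespace false -- `Summit.PneNP.PneNP.…`: summit = sub-problem (D-0017)

noncomputable section

namespace Summit.PneNP.PneNP.Theorems.ChebyshevTracialDesignGammaDirectionCriterion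

open Finset Polynomial Literature.Barriers.PneNP Literature.Combinatorics.Optimization
open Literature.Combinatorics.Optimization.ShellStep
open Summit.PneNP.PneNP.Theorems.ChebyshevTracialDesignVirtualPositivityCriterion (newtonPolyOdd_eval_zero_mixture_ge
  shellLaw_nonneg')

variable {n : ℕ}

/-! ### §1 The abstract centred-basis criterion -/

/-- **Relative smoothness of a `2×2` quadratic form from its centred entries.** For sequences `A, B, C : ℕ → ℝ` with `A 0, C 0 ≥ 0`, `B 0 = 0`, and
`Σ_{k=1}^D c_k|Δ^kA(0)| ≤ ε_A·A 0`, `Σ c_k|Δ^kB(0)| ≤ ε_B·√(A 0·C 0)`, `Σ c_k|Δ^kC(0)| ≤ ε_C·C 0` (`c_k = C(2k,k)/4^k`), `0 ≤ ε_B`, `ε_A + ε_B ≤ 1`,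
`ε_C + ε_B ≤ 1`: the sequence `Q_j = γ²A_j + 2γℓB_j + ℓ²C_j` satisfies `Σ_{k=1}^D c_k|Δ^kQ(0)| ≤ Q_0` for every `γ, ℓ`
(linearity of `Δ^k`, the triangle inequality, and `2|γ||ℓ|√(A 0·C 0) ≤ γ²A 0 + ℓ²C 0`). [cite: Agarwal2000DifferenceEquations, Thm. 1.8.5 (1.8.6)] -/
theorem sum_abs_fwdDiff_quadForm_le (D : ℕ) (A B C : ℕ → ℝ) (γ ℓ εA εB εC : ℝ)
    (hA0 : 0 ≤ A 0) (hC0 : 0 ≤ C 0) (hB0 : B 0 = 0) (hεB : 0 ≤ εB) (h1 : εA + εB ≤ 1) (h2 : εC + εB ≤ 1)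
    (hA : ∑ k ∈ Ico 1 (D + 1), (((2 * k).choose k : ℕ) : ℝ) / (4 : ℝ) ^ k * |(fwdDiff (1 : ℕ))^[k] A 0| ≤ εA * A 0)
    (hB : ∑ k ∈ Ico 1 (D + 1), (((2 * k).choose k : ℕ) : ℝ) / (4 : ℝ) ^ k * |(fwdDiff (1 : ℕ))^[k] B 0| ≤
      εB * Real.sqrt (A 0 * C 0))
    (hC : ∑ k ∈ Ico 1 (D + 1), (((2 * k).choose k : ℕ) : ℝ) / (4 : ℝ) ^ k * |(fwdDiff (1 : ℕ))^[k] C 0| ≤ εC * C 0) :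
    ∑ k ∈ Ico 1 (D + 1), (((2 * k).choose k : ℕ) : ℝ) / (4 : ℝ) ^ k *
        |(fwdDiff (1 : ℕ))^[k] (fun j => γ ^ 2 * A j + 2 * γ * ℓ * B j + ℓ ^ 2 * C j) 0| ≤
      γ ^ 2 * A 0 + 2 * γ * ℓ * B 0 + ℓ ^ 2 * C 0 := by
  have hc0 : ∀ k : ℕ, 0 ≤ (((2 * k).choose k : ℕ) : ℝ) / (4 : ℝ) ^ k := fun k => by positivity
  have hlin : ∀ k, (fwdDiff (1 : ℕ))^[k] (fun j => γ ^ 2 * A j + 2 * γ * ℓ * B j + ℓ ^ 2 * C j) 0 =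
      γ ^ 2 * (fwdDiff (1 : ℕ))^[k] A 0 + 2 * γ * ℓ * (fwdDiff (1 : ℕ))^[k] B 0 + ℓ ^ 2 * (fwdDiff (1 : ℕ))^[k] C 0 := by
    intro k
    have e : (fun j => γ ^ 2 * A j + 2 * γ * ℓ * B j + ℓ ^ 2 * C j) = (γ ^ 2 • A + (2 * γ * ℓ) • B) + ℓ ^ 2 • C := by
      funext j; simp only [Pi.add_apply, Pi.smul_apply, smul_eq_mul]
    rw [e, fwdDiff_iter_add, fwdDiff_iter_add, fwdDiff_iter_const_smul, fwdDiff_iter_const_smul, fwdDiff_iter_const_smul]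
    simp only [Pi.add_apply, Pi.smul_apply, smul_eq_mul]
  have hterm : ∀ k ∈ Ico 1 (D + 1), (((2 * k).choose k : ℕ) : ℝ) / (4 : ℝ) ^ k *
      |(fwdDiff (1 : ℕ))^[k] (fun j => γ ^ 2 * A j + 2 * γ * ℓ * B j + ℓ ^ 2 * C j) 0| ≤
      γ ^ 2 * ((((2 * k).choose k : ℕ) : ℝ) / (4 : ℝ) ^ k * |(fwdDiff (1 : ℕ))^[k] A 0|) +
        2 * (|γ| * |ℓ|) * ((((2 * k).choose k : ℕ) : ℝ) / (4 : ℝ) ^ k * |(fwdDiff (1 : ℕ))^[k] B 0|) +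
        ℓ ^ 2 * ((((2 * k).choose k : ℕ) : ℝ) / (4 : ℝ) ^ k * |(fwdDiff (1 : ℕ))^[k] C 0|) := by
    intro k _
    rw [hlin k]
    have t1 := abs_add_le (γ ^ 2 * (fwdDiff (1 : ℕ))^[k] A 0 + 2 * γ * ℓ * (fwdDiff (1 : ℕ))^[k] B 0)
      (ℓ ^ 2 * (fwdDiff (1 : ℕ))^[k] C 0)
    have t2 := abs_add_le (γ ^ 2 * (fwdDiff (1 : ℕ))^[k] A 0) (2 * γ * ℓ * (fwdDiff (1 : ℕ))^[k] B 0)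
    have e1 : |γ ^ 2 * (fwdDiff (1 : ℕ))^[k] A 0| = γ ^ 2 * |(fwdDiff (1 : ℕ))^[k] A 0| := by
      rw [abs_mul, abs_of_nonneg (sq_nonneg γ)]
    have e2 : |2 * γ * ℓ * (fwdDiff (1 : ℕ))^[k] B 0| = 2 * (|γ| * |ℓ|) * |(fwdDiff (1 : ℕ))^[k] B 0| := by
      rw [abs_mul, abs_mul, abs_mul, abs_two]; ring
    have e3 : |ℓ ^ 2 * (fwdDiff (1 : ℕ))^[k] C 0| = ℓ ^ 2 * |(fwdDiff (1 : ℕ))^[k] C 0| := by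
      rw [abs_mul, abs_of_nonneg (sq_nonneg ℓ)]
    rw [e3] at t1
    rw [e1, e2] at t2
    calc (((2 * k).choose k : ℕ) : ℝ) / (4 : ℝ) ^ k *
          |γ ^ 2 * (fwdDiff (1 : ℕ))^[k] A 0 + 2 * γ * ℓ * (fwdDiff (1 : ℕ))^[k] B 0 + ℓ ^ 2 * (fwdDiff (1 : ℕ))^[k] C 0|
        ≤ (((2 * k).choose k : ℕ) : ℝ) / (4 : ℝ) ^ k * (γ ^ 2 * |(fwdDiff (1 : ℕ))^[k] A 0| +
            2 * (|γ| * |ℓ|) * |(fwdDiff (1 : ℕ))^[k] B 0| + ℓ ^ 2 * |(fwdDiff (1 : ℕ))^[k] C 0|) :=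
          mul_le_mul_of_nonneg_left (by linarith) (hc0 k)
      _ = _ := by ring
  have hsum := sum_le_sum hterm
  rw [sum_add_distrib, sum_add_distrib, ← mul_sum, ← mul_sum, ← mul_sum] at hsum
  -- `2|γ||ℓ|√(A₀C₀) ≤ γ²A₀ + ℓ²C₀`
  have hag : 2 * (|γ| * |ℓ|) * Real.sqrt (A 0 * C 0) ≤ γ ^ 2 * A 0 + ℓ ^ 2 * C 0 := by
    rw [Real.sqrt_mul hA0]
    have hu : (|γ| * Real.sqrt (A 0)) ^ 2 = γ ^ 2 * A 0 := by rw [mul_pow, sq_abs, Real.sq_sqrt hA0]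
    have hv : (|ℓ| * Real.sqrt (C 0)) ^ 2 = ℓ ^ 2 * C 0 := by rw [mul_pow, sq_abs, Real.sq_sqrt hC0]
    nlinarith [sq_nonneg (|γ| * Real.sqrt (A 0) - |ℓ| * Real.sqrt (C 0))]
  have hγ0 : 0 ≤ γ ^ 2 * A 0 := mul_nonneg (sq_nonneg _) hA0
  have hℓ0 : 0 ≤ ℓ ^ 2 * C 0 := mul_nonneg (sq_nonneg _) hC0
  have hγℓ : 0 ≤ 2 * (|γ| * |ℓ|) := by positivity
  calc ∑ k ∈ Ico 1 (D + 1), (((2 * k).choose k : ℕ) : ℝ) / (4 : ℝ) ^ k *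
          |(fwdDiff (1 : ℕ))^[k] (fun j => γ ^ 2 * A j + 2 * γ * ℓ * B j + ℓ ^ 2 * C j) 0|
      ≤ γ ^ 2 * ∑ k ∈ Ico 1 (D + 1), (((2 * k).choose k : ℕ) : ℝ) / (4 : ℝ) ^ k * |(fwdDiff (1 : ℕ))^[k] A 0| +
          2 * (|γ| * |ℓ|) * ∑ k ∈ Ico 1 (D + 1), (((2 * k).choose k : ℕ) : ℝ) / (4 : ℝ) ^ k * |(fwdDiff (1 : ℕ))^[k] B 0| +
          ℓ ^ 2 * ∑ k ∈ Ico 1 (D + 1), (((2 * k).choose k : ℕ) : ℝ) / (4 : ℝ) ^ k * |(fwdDiff (1 : ℕ))^[k] C 0| := hsum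
    _ ≤ γ ^ 2 * (εA * A 0) + 2 * (|γ| * |ℓ|) * (εB * Real.sqrt (A 0 * C 0)) + ℓ ^ 2 * (εC * C 0) := by
        gcongr
    _ = εA * (γ ^ 2 * A 0) + εB * (2 * (|γ| * |ℓ|) * Real.sqrt (A 0 * C 0)) + εC * (ℓ ^ 2 * C 0) := by ring
    _ ≤ εA * (γ ^ 2 * A 0) + εB * (γ ^ 2 * A 0 + ℓ ^ 2 * C 0) + εC * (ℓ ^ 2 * C 0) := by
        gcongr
    _ = (εA + εB) * (γ ^ 2 * A 0) + (εC + εB) * (ℓ ^ 2 * C 0) := by ring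
    _ ≤ 1 * (γ ^ 2 * A 0) + 1 * (ℓ ^ 2 * C 0) := by gcongr
    _ = γ ^ 2 * A 0 + 2 * γ * ℓ * B 0 + ℓ ^ 2 * C 0 := by rw [hB0]; ring

/-! ### §2 The `x`-sections of the γ-direction profile -/

/-- **Fiberwise**: `Φ(c) = Σ_{x∈[0,t]} ψ(x)·Q_c(x)`, `Q_c(x) = (Σ_{U ∈ Shell_c(M), |U∩H| = x} (2γ n_A(U) + 2λx + κt)²)/|Shell_c(M)|`.
[cite: Rothvoss2017, §2 (PDF p. 6)] -/
theorem gammaProfile_eq_sum_sections (t : ℕ) (M : PMatch n) (H : Finset (Fin n)) (ψ : ℤ → ℝ) (gam lam kap : ℝ) (c : ℕ) :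
    (∑ U' ∈ shell M.2.partner t c,
        ψ ((U' ∩ H).card : ℤ) *
          (2 * gam * ((((reps M.2.partner (vAA M.2.partner univ H)).filter fun v => v ∈ U' ∧ M.2.partner v ∈ U').card : ℕ) : ℝ) +
            2 * lam * ((U' ∩ H).card : ℤ) + kap * (t : ℝ)) ^ 2) /
        ((shell M.2.partner t c).card : ℝ) =
      ∑ x ∈ Icc (0 : ℤ) t, ψ x * ((∑ U ∈ ((shell M.2.partner t c).filter fun U => ((U ∩ H).card : ℤ) = x),
          (2 * gam * ((((reps M.2.partner (vAA M.2.partner univ H)).filter fun v => v ∈ U ∧ M.2.partner v ∈ U).card : ℕ) : ℝ) +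
            2 * lam * (x : ℝ) + kap * (t : ℝ)) ^ 2) / ((shell M.2.partner t c).card : ℝ)) := by
  have hmaps : ∀ U ∈ shell M.2.partner t c, ((U ∩ H).card : ℤ) ∈ Icc (0 : ℤ) t := by
    intro U hU
    rw [mem_Icc]
    refine ⟨by positivity, ?_⟩
    have h1 : (U ∩ H).card ≤ U.card := card_le_card inter_subset_left
    have h2 : U.card = t := by
      rw [← shellIn_univ] at hU; exact (mem_shellIn.1 hU).2.1
    exact_mod_cast h2 ▸ h1
  rw [← sum_fiberwise_of_maps_to hmaps, sum_div]
  refine sum_congr rfl fun x _ => ?_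
  rw [mul_div_assoc', mul_sum]
  congr 1
  refine sum_congr rfl fun U hU => ?_
  have hx : ((U ∩ H).card : ℤ) = x := (mem_filter.1 hU).2
  have hxR : (x : ℝ) = (((U ∩ H).card : ℤ) : ℝ) := by exact_mod_cast hx.symm
  rw [hxR, hx]

/-- The sections are nonnegative at every level. [cite: Rothvoss2017, §2 (PDF p. 6)] -/
theorem gammaSection_nonneg (t : ℕ) (M : PMatch n) (H : Finset (Fin n)) (gam lam kap : ℝ) (c : ℕ) (x : ℤ) :
    0 ≤ ((∑ U ∈ ((shell M.2.partner t c).filter fun U => ((U ∩ H).card : ℤ) = x),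
          (2 * gam * ((((reps M.2.partner (vAA M.2.partner univ H)).filter fun v => v ∈ U ∧ M.2.partner v ∈ U).card : ℕ) : ℝ) +
            2 * lam * (x : ℝ) + kap * (t : ℝ)) ^ 2) / ((shell M.2.partner t c).card : ℝ)) :=
  div_nonneg (sum_nonneg fun _ _ => sq_nonneg _) (Nat.cast_nonneg _)

/-- **The sections are dominated by the law**: for `|γ|, |λ|, |κ| ≤ 1` and `x ∈ [0,t]`, `Q_c(x) ≤ (2n + 3t)²·law_c(x)` (`n_A ≤ n`, `|2λx + κt| ≤ 3t`).
[cite: Rothvoss2017, §2 (PDF p. 6)] -/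
theorem gammaSection_le_law (t : ℕ) (M : PMatch n) (H : Finset (Fin n)) {gam lam kap : ℝ} (hgam : |gam| ≤ 1) (hlam : |lam| ≤ 1)
    (hkap : |kap| ≤ 1) (c : ℕ) {x : ℤ} (hx : x ∈ Icc (0 : ℤ) t) :
    ((∑ U ∈ ((shell M.2.partner t c).filter fun U => ((U ∩ H).card : ℤ) = x),
          (2 * gam * ((((reps M.2.partner (vAA M.2.partner univ H)).filter fun v => v ∈ U ∧ M.2.partner v ∈ U).card : ℕ) : ℝ) +
            2 * lam * (x : ℝ) + kap * (t : ℝ)) ^ 2) / ((shell M.2.partner t c).card : ℝ)) ≤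
      (2 * (n : ℝ) + 3 * (t : ℝ)) ^ 2 * shellLaw M.2.partner univ H t c x := by
  rw [mem_Icc] at hx
  have hx0 : (0 : ℝ) ≤ x := by exact_mod_cast hx.1
  have hxt : (x : ℝ) ≤ t := by exact_mod_cast hx.2
  have hg := abs_le.1 hgam; have hl := abs_le.1 hlam; have hk := abs_le.1 hkap
  have hpt : ∀ U ∈ ((shell M.2.partner t c).filter fun U => ((U ∩ H).card : ℤ) = x),
      (2 * gam * ((((reps M.2.partner (vAA M.2.partner univ H)).filter fun v => v ∈ U ∧ M.2.partner v ∈ U).card : ℕ) : ℝ) +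
        2 * lam * (x : ℝ) + kap * (t : ℝ)) ^ 2 ≤ (2 * (n : ℝ) + 3 * (t : ℝ)) ^ 2 := by
    intro U _
    have hN : ((((reps M.2.partner (vAA M.2.partner univ H)).filter fun v => v ∈ U ∧ M.2.partner v ∈ U).card : ℕ) : ℝ) ≤ n := by
      have h := card_le_univ ((reps M.2.partner (vAA M.2.partner univ H)).filter fun v => v ∈ U ∧ M.2.partner v ∈ U)
      rw [Fintype.card_fin] at h
      exact_mod_cast h
    have hN0 : 0 ≤ ((((reps M.2.partner (vAA M.2.partner univ H)).filter fun v => v ∈ U ∧ M.2.partner v ∈ U).card : ℕ) : ℝ) := Nat.cast_nonneg _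
    have hgN : |gam * ((((reps M.2.partner (vAA M.2.partner univ H)).filter fun v => v ∈ U ∧ M.2.partner v ∈ U).card : ℕ) : ℝ)| ≤
        ((((reps M.2.partner (vAA M.2.partner univ H)).filter fun v => v ∈ U ∧ M.2.partner v ∈ U).card : ℕ) : ℝ) := by
      rw [abs_mul, abs_of_nonneg hN0]; exact mul_le_of_le_one_left hN0 hgam
    have hlx : |lam * (x : ℝ)| ≤ (x : ℝ) := by
      rw [abs_mul, abs_of_nonneg hx0]; exact mul_le_of_le_one_left hx0 hlam
    have hkt : |kap * (t : ℝ)| ≤ (t : ℝ) := by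
      rw [abs_mul, Nat.abs_cast]; exact mul_le_of_le_one_left (Nat.cast_nonneg _) hkap
    have f1 := abs_le.1 hgN
    have f2 := abs_le.1 hlx
    have f3 := abs_le.1 hkt
    apply sq_le_sq' <;> nlinarith [f1.1, f1.2, f2.1, f2.2, f3.1, f3.2, hN, hxt, hx0]
  rw [shellLaw, shellCount, shellIn_univ]
  calc (∑ U ∈ ((shell M.2.partner t c).filter fun U => ((U ∩ H).card : ℤ) = x),
          (2 * gam * ((((reps M.2.partner (vAA M.2.partner univ H)).filter fun v => v ∈ U ∧ M.2.partner v ∈ U).card : ℕ) : ℝ) +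
            2 * lam * (x : ℝ) + kap * (t : ℝ)) ^ 2) / ((shell M.2.partner t c).card : ℝ)
      ≤ (∑ U ∈ ((shell M.2.partner t c).filter fun U => ((U ∩ H).card : ℤ) = x),
          (2 * (n : ℝ) + 3 * (t : ℝ)) ^ 2) / ((shell M.2.partner t c).card : ℝ) :=
        div_le_div_of_nonneg_right (sum_le_sum hpt) (Nat.cast_nonneg _)
    _ = _ := by rw [sum_const, nsmul_eq_mul]; ring

/-- **The sections in the centred basis**: for every real `m`,
`Q_c(x) = (2γ)²·A^m_c(x) + 2(2γ)ℓ·B^m_c(x) + ℓ²·law_c(x)`, `ℓ = 2λx + κt + 2γm`, `A^m_c(x) = (Σ_{U: |U∩H|=x} (n_A(U) − m)²)/|Shell_c|`,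
`B^m_c(x) = (Σ_{U: |U∩H|=x} (n_A(U) − m))/|Shell_c|` (`2γ n_A + 2λx + κt = 2γ(n_A − m) + ℓ`). [cite: Rothvoss2017, §2 (PDF p. 6)] -/
theorem gammaSection_eq_centred (t : ℕ) (M : PMatch n) (H : Finset (Fin n)) (gam lam kap : ℝ) (mf : ℤ → ℝ) (c : ℕ) (x : ℤ) :
    ((∑ U ∈ ((shell M.2.partner t c).filter fun U => ((U ∩ H).card : ℤ) = x),
          (2 * gam * ((((reps M.2.partner (vAA M.2.partner univ H)).filter fun v => v ∈ U ∧ M.2.partner v ∈ U).card : ℕ) : ℝ) +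
            2 * lam * (x : ℝ) + kap * (t : ℝ)) ^ 2) / ((shell M.2.partner t c).card : ℝ)) =
      (2 * gam) ^ 2 * ((∑ U ∈ ((shell M.2.partner t c).filter fun U => ((U ∩ H).card : ℤ) = x),
          (((((reps M.2.partner (vAA M.2.partner univ H)).filter fun v => v ∈ U ∧ M.2.partner v ∈ U).card : ℕ) : ℝ) - mf x) ^ 2) /
          ((shell M.2.partner t c).card : ℝ)) +
        2 * (2 * gam) * (2 * lam * (x : ℝ) + kap * (t : ℝ) + 2 * gam * mf x) *
          ((∑ U ∈ ((shell M.2.partner t c).filter fun U => ((U ∩ H).card : ℤ) = x),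
          (((((reps M.2.partner (vAA M.2.partner univ H)).filter fun v => v ∈ U ∧ M.2.partner v ∈ U).card : ℕ) : ℝ) - mf x)) /
          ((shell M.2.partner t c).card : ℝ)) +
        (2 * lam * (x : ℝ) + kap * (t : ℝ) + 2 * gam * mf x) ^ 2 * shellLaw M.2.partner univ H t c x := by
  have hs : ∑ U ∈ ((shell M.2.partner t c).filter fun U => ((U ∩ H).card : ℤ) = x),
      (2 * gam * ((((reps M.2.partner (vAA M.2.partner univ H)).filter fun v => v ∈ U ∧ M.2.partner v ∈ U).card : ℕ) : ℝ) +
        2 * lam * (x : ℝ) + kap * (t : ℝ)) ^ 2 =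
      (2 * gam) ^ 2 * ∑ U ∈ ((shell M.2.partner t c).filter fun U => ((U ∩ H).card : ℤ) = x),
          (((((reps M.2.partner (vAA M.2.partner univ H)).filter fun v => v ∈ U ∧ M.2.partner v ∈ U).card : ℕ) : ℝ) - mf x) ^ 2 +
        2 * (2 * gam) * (2 * lam * (x : ℝ) + kap * (t : ℝ) + 2 * gam * mf x) *
          ∑ U ∈ ((shell M.2.partner t c).filter fun U => ((U ∩ H).card : ℤ) = x),
            (((((reps M.2.partner (vAA M.2.partner univ H)).filter fun v => v ∈ U ∧ M.2.partner v ∈ U).card : ℕ) : ℝ) - mf x) +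
        (2 * lam * (x : ℝ) + kap * (t : ℝ) + 2 * gam * mf x) ^ 2 * ∑ U ∈ ((shell M.2.partner t c).filter fun U => ((U ∩ H).card : ℤ) = x), (1 : ℝ) := by
    rw [mul_sum, mul_sum, mul_sum, ← sum_add_distrib, ← sum_add_distrib]
    exact sum_congr rfl fun U _ => by ring
  rw [shellLaw, shellCount, shellIn_univ, card_eq_sum_ones ((shell M.2.partner t c).filter fun U => ((U ∩ H).card : ℤ) = x), hs]
  push_cast
  ring

/-! ### §3 The criterion for the γ-direction main term -/

/-- **Brick 121 on the sections**: for `0 ≤ ψ ≤ G` on `[0,t]` and a window `B ⊆ [0,t]` on which the section profiles are relatively level-smooth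
(`Σ_{k=1}^D (C(2k,k)/4^k)|Δ^k[j ↦ Q_{2j+1}(x)](0)| ≤ Q_1(x)`), `N^{odd}_D[Φ](0) ≥ −2^{D+1}G·Σ_{x∈[0,t]∖B} Σ_{j≤D} Q_{2j+1}(x)`.
[cite: Agarwal2000DifferenceEquations, Thm. 1.8.5 (1.8.6), Remark 1.8.1 (1.8.8)] [cite: Rothvoss2017, §2 (PDF p. 6)] -/
theorem gammaProfile_newton_eval_zero_ge (D t : ℕ) (M : PMatch n) (H : Finset (Fin n)) (ψ : ℤ → ℝ) {G : ℝ}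
    (hψ0 : ∀ x ∈ Icc (0 : ℤ) t, 0 ≤ ψ x) (hψG : ∀ x ∈ Icc (0 : ℤ) t, ψ x ≤ G) (gam lam kap : ℝ)
    (B : Finset ℤ) (hB : B ⊆ Icc (0 : ℤ) t)
    (hbulk : ∀ x ∈ B, ∑ k ∈ Ico 1 (D + 1), (((2 * k).choose k : ℕ) : ℝ) / (4 : ℝ) ^ k *
        |(fwdDiff (1 : ℕ))^[k] (fun j => ((∑ U ∈ ((shell M.2.partner t (2 * j + 1)).filter fun U => ((U ∩ H).card : ℤ) = x),
          (2 * gam * ((((reps M.2.partner (vAA M.2.partner univ H)).filter fun v => v ∈ U ∧ M.2.partner v ∈ U).card : ℕ) : ℝ) +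
            2 * lam * (x : ℝ) + kap * (t : ℝ)) ^ 2) / ((shell M.2.partner t (2 * j + 1)).card : ℝ))) 0| ≤
      ((∑ U ∈ ((shell M.2.partner t 1).filter fun U => ((U ∩ H).card : ℤ) = x),
          (2 * gam * ((((reps M.2.partner (vAA M.2.partner univ H)).filter fun v => v ∈ U ∧ M.2.partner v ∈ U).card : ℕ) : ℝ) +
            2 * lam * (x : ℝ) + kap * (t : ℝ)) ^ 2) / ((shell M.2.partner t 1).card : ℝ))) :
    -((2 : ℝ) ^ (D + 1) * G * ∑ x ∈ Icc (0 : ℤ) t \ B, ∑ j ∈ range (D + 1),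
        ((∑ U ∈ ((shell M.2.partner t (2 * j + 1)).filter fun U => ((U ∩ H).card : ℤ) = x),
          (2 * gam * ((((reps M.2.partner (vAA M.2.partner univ H)).filter fun v => v ∈ U ∧ M.2.partner v ∈ U).card : ℕ) : ℝ) +
            2 * lam * (x : ℝ) + kap * (t : ℝ)) ^ 2) / ((shell M.2.partner t (2 * j + 1)).card : ℝ))) ≤
      (DesignRemainder.newtonPolyOdd D (fun c => (∑ U' ∈ shell M.2.partner t c,
          ψ ((U' ∩ H).card : ℤ) *
            (2 * gam * ((((reps M.2.partner (vAA M.2.partner univ H)).filter fun v => v ∈ U' ∧ M.2.partner v ∈ U').card : ℕ) : ℝ) +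
              2 * lam * ((U' ∩ H).card : ℤ) + kap * (t : ℝ)) ^ 2) /
          ((shell M.2.partner t c).card : ℝ))).eval 0 := by
  have hfun : (fun c => (∑ U' ∈ shell M.2.partner t c,
          ψ ((U' ∩ H).card : ℤ) *
            (2 * gam * ((((reps M.2.partner (vAA M.2.partner univ H)).filter fun v => v ∈ U' ∧ M.2.partner v ∈ U').card : ℕ) : ℝ) +
              2 * lam * ((U' ∩ H).card : ℤ) + kap * (t : ℝ)) ^ 2) /
          ((shell M.2.partner t c).card : ℝ)) =
      fun c => ∑ x ∈ Icc (0 : ℤ) t, ψ x * ((∑ U ∈ ((shell M.2.partner t c).filter fun U => ((U ∩ H).card : ℤ) = x),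
          (2 * gam * ((((reps M.2.partner (vAA M.2.partner univ H)).filter fun v => v ∈ U ∧ M.2.partner v ∈ U).card : ℕ) : ℝ) +
            2 * lam * (x : ℝ) + kap * (t : ℝ)) ^ 2) / ((shell M.2.partner t c).card : ℝ)) := by
    funext c; exact gammaProfile_eq_sum_sections t M H ψ gam lam kap c
  rw [hfun]
  exact newtonPolyOdd_eval_zero_mixture_ge D (Icc (0 : ℤ) t) B hB
    (fun c x => ((∑ U ∈ ((shell M.2.partner t c).filter fun U => ((U ∩ H).card : ℤ) = x),
          (2 * gam * ((((reps M.2.partner (vAA M.2.partner univ H)).filter fun v => v ∈ U ∧ M.2.partner v ∈ U).card : ℕ) : ℝ) +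
            2 * lam * (x : ℝ) + kap * (t : ℝ)) ^ 2) / ((shell M.2.partner t c).card : ℝ)))
    (fun c x => gammaSection_nonneg t M H gam lam kap c x) ψ hψ0 hψG hbulk

/-- **THE CRITERION FOR THE γ-DIRECTION (brick 130).** Let `0 ≤ ψ ≤ G` on `[0,t]`, `|γ|,|λ|,|κ| ≤ 1`, a window `B ⊆ [0,t]`, a centring `m : ℤ → ℝ` and
`ε_A, ε_B, ε_C` with `0 ≤ ε_B`, `ε_A + ε_B ≤ 1`, `ε_C + ε_B ≤ 1` such that at every `x ∈ B`: the centred first-moment section vanishes at level `1`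
(`B^m_1(x) = 0`, e.g. `m(x) = E_1[n_A | X = x]`), and the three level profiles `c ↦ A^m_c(x)`, `B^m_c(x)`, `law_c(x)` are relatively smooth to order `D`:
`Σ_{k=1}^D c_k|Δ^k A^m_·(x)| ≤ ε_A A^m_1(x)`, `Σ c_k|Δ^k B^m_·(x)| ≤ ε_B √(A^m_1(x)·law_1(x))`, `Σ c_k|Δ^k law_·(x)| ≤ ε_C law_1(x)` (odd levels, `c_k = C(2k,k)/4^k`).
Then `N^{odd}_D[Φ](0) ≥ −2^{D+1}·G·(2n+3t)²·Σ_{x∈[0,t]∖B} Σ_{j≤D} law_{2j+1}(x)`: the γ-direction main term of brick 129 is virtually nonnegative up to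
the tail mass of the `D+1` odd-level laws outside the window — MEMO-28 §3c (i)–(iii) ⇒ (O3), uniformly in the direction.
[cite: Agarwal2000DifferenceEquations, Thm. 1.8.5 (1.8.6), Remark 1.8.1 (1.8.8)] [cite: Rivlin1974, Sect. 1.3 (1.32)–(1.34)]
[cite: Rothvoss2017, §2 (PDF p. 6)] -/
theorem gammaProfile_newton_eval_zero_ge_of_centred (D t : ℕ) (M : PMatch n) (H : Finset (Fin n)) (ψ : ℤ → ℝ) {G : ℝ}
    (hψ0 : ∀ x ∈ Icc (0 : ℤ) t, 0 ≤ ψ x) (hψG : ∀ x ∈ Icc (0 : ℤ) t, ψ x ≤ G)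
    {gam lam kap : ℝ} (hgam : |gam| ≤ 1) (hlam : |lam| ≤ 1) (hkap : |kap| ≤ 1)
    (B : Finset ℤ) (hB : B ⊆ Icc (0 : ℤ) t) (mf : ℤ → ℝ) {εA εB εC : ℝ} (hεB : 0 ≤ εB) (h1 : εA + εB ≤ 1) (h2 : εC + εB ≤ 1)
    (hcentre : ∀ x ∈ B, ((∑ U ∈ ((shell M.2.partner t 1).filter fun U => ((U ∩ H).card : ℤ) = x),
          (((((reps M.2.partner (vAA M.2.partner univ H)).filter fun v => v ∈ U ∧ M.2.partner v ∈ U).card : ℕ) : ℝ) - mf x)) /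
          ((shell M.2.partner t 1).card : ℝ)) = 0)
    (hA : ∀ x ∈ B, ∑ k ∈ Ico 1 (D + 1), (((2 * k).choose k : ℕ) : ℝ) / (4 : ℝ) ^ k *
        |(fwdDiff (1 : ℕ))^[k] (fun j => ((∑ U ∈ ((shell M.2.partner t (2 * j + 1)).filter fun U => ((U ∩ H).card : ℤ) = x),
          (((((reps M.2.partner (vAA M.2.partner univ H)).filter fun v => v ∈ U ∧ M.2.partner v ∈ U).card : ℕ) : ℝ) - mf x) ^ 2) /
          ((shell M.2.partner t (2 * j + 1)).card : ℝ))) 0| ≤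
      εA * ((∑ U ∈ ((shell M.2.partner t 1).filter fun U => ((U ∩ H).card : ℤ) = x),
          (((((reps M.2.partner (vAA M.2.partner univ H)).filter fun v => v ∈ U ∧ M.2.partner v ∈ U).card : ℕ) : ℝ) - mf x) ^ 2) /
          ((shell M.2.partner t 1).card : ℝ)))
    (hBm : ∀ x ∈ B, ∑ k ∈ Ico 1 (D + 1), (((2 * k).choose k : ℕ) : ℝ) / (4 : ℝ) ^ k *
        |(fwdDiff (1 : ℕ))^[k] (fun j => ((∑ U ∈ ((shell M.2.partner t (2 * j + 1)).filter fun U => ((U ∩ H).card : ℤ) = x),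
          (((((reps M.2.partner (vAA M.2.partner univ H)).filter fun v => v ∈ U ∧ M.2.partner v ∈ U).card : ℕ) : ℝ) - mf x)) /
          ((shell M.2.partner t (2 * j + 1)).card : ℝ))) 0| ≤
      εB * Real.sqrt (((∑ U ∈ ((shell M.2.partner t 1).filter fun U => ((U ∩ H).card : ℤ) = x),
          (((((reps M.2.partner (vAA M.2.partner univ H)).filter fun v => v ∈ U ∧ M.2.partner v ∈ U).card : ℕ) : ℝ) - mf x) ^ 2) /
          ((shell M.2.partner t 1).card : ℝ)) * shellLaw M.2.partner univ H t 1 x))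
    (hC : ∀ x ∈ B, ∑ k ∈ Ico 1 (D + 1), (((2 * k).choose k : ℕ) : ℝ) / (4 : ℝ) ^ k *
        |(fwdDiff (1 : ℕ))^[k] (fun j => shellLaw M.2.partner univ H t (2 * j + 1) x) 0| ≤ εC * shellLaw M.2.partner univ H t 1 x) :
    -((2 : ℝ) ^ (D + 1) * G * (2 * (n : ℝ) + 3 * (t : ℝ)) ^ 2 *
        ∑ x ∈ Icc (0 : ℤ) t \ B, ∑ j ∈ range (D + 1), shellLaw M.2.partner univ H t (2 * j + 1) x) ≤
      (DesignRemainder.newtonPolyOdd D (fun c => (∑ U' ∈ shell M.2.partner t c,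
          ψ ((U' ∩ H).card : ℤ) *
            (2 * gam * ((((reps M.2.partner (vAA M.2.partner univ H)).filter fun v => v ∈ U' ∧ M.2.partner v ∈ U').card : ℕ) : ℝ) +
              2 * lam * ((U' ∩ H).card : ℤ) + kap * (t : ℝ)) ^ 2) /
          ((shell M.2.partner t c).card : ℝ))).eval 0 := by
  have h0 : (0 : ℤ) ∈ Icc (0 : ℤ) t := by rw [mem_Icc]; exact ⟨le_rfl, by positivity⟩
  have hG0 : 0 ≤ G := le_trans (hψ0 0 h0) (hψG 0 h0)
  -- the bulk criterion for the sections, from §1 in the centred basis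
  have hbulk : ∀ x ∈ B, ∑ k ∈ Ico 1 (D + 1), (((2 * k).choose k : ℕ) : ℝ) / (4 : ℝ) ^ k *
        |(fwdDiff (1 : ℕ))^[k] (fun j => ((∑ U ∈ ((shell M.2.partner t (2 * j + 1)).filter fun U => ((U ∩ H).card : ℤ) = x),
          (2 * gam * ((((reps M.2.partner (vAA M.2.partner univ H)).filter fun v => v ∈ U ∧ M.2.partner v ∈ U).card : ℕ) : ℝ) +
            2 * lam * (x : ℝ) + kap * (t : ℝ)) ^ 2) / ((shell M.2.partner t (2 * j + 1)).card : ℝ))) 0| ≤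
      ((∑ U ∈ ((shell M.2.partner t 1).filter fun U => ((U ∩ H).card : ℤ) = x),
          (2 * gam * ((((reps M.2.partner (vAA M.2.partner univ H)).filter fun v => v ∈ U ∧ M.2.partner v ∈ U).card : ℕ) : ℝ) +
            2 * lam * (x : ℝ) + kap * (t : ℝ)) ^ 2) / ((shell M.2.partner t 1).card : ℝ)) := by
    intro x hx
    have e : (fun j : ℕ => ((∑ U ∈ ((shell M.2.partner t (2 * j + 1)).filter fun U => ((U ∩ H).card : ℤ) = x),
          (2 * gam * ((((reps M.2.partner (vAA M.2.partner univ H)).filter fun v => v ∈ U ∧ M.2.partner v ∈ U).card : ℕ) : ℝ) +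
            2 * lam * (x : ℝ) + kap * (t : ℝ)) ^ 2) / ((shell M.2.partner t (2 * j + 1)).card : ℝ))) =
        fun j : ℕ => (2 * gam) ^ 2 * ((∑ U ∈ ((shell M.2.partner t (2 * j + 1)).filter fun U => ((U ∩ H).card : ℤ) = x),
          (((((reps M.2.partner (vAA M.2.partner univ H)).filter fun v => v ∈ U ∧ M.2.partner v ∈ U).card : ℕ) : ℝ) - mf x) ^ 2) /
          ((shell M.2.partner t (2 * j + 1)).card : ℝ)) +
          2 * (2 * gam) * (2 * lam * (x : ℝ) + kap * (t : ℝ) + 2 * gam * mf x) *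
            ((∑ U ∈ ((shell M.2.partner t (2 * j + 1)).filter fun U => ((U ∩ H).card : ℤ) = x),
          (((((reps M.2.partner (vAA M.2.partner univ H)).filter fun v => v ∈ U ∧ M.2.partner v ∈ U).card : ℕ) : ℝ) - mf x)) /
          ((shell M.2.partner t (2 * j + 1)).card : ℝ)) +
          (2 * lam * (x : ℝ) + kap * (t : ℝ) + 2 * gam * mf x) ^ 2 * shellLaw M.2.partner univ H t (2 * j + 1) x := by
      funext j; exact gammaSection_eq_centred t M H gam lam kap mf (2 * j + 1) x
    rw [e, gammaSection_eq_centred t M H gam lam kap mf 1 x]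
    have key := sum_abs_fwdDiff_quadForm_le D
      (fun j : ℕ => ((∑ U ∈ ((shell M.2.partner t (2 * j + 1)).filter fun U => ((U ∩ H).card : ℤ) = x),
          (((((reps M.2.partner (vAA M.2.partner univ H)).filter fun v => v ∈ U ∧ M.2.partner v ∈ U).card : ℕ) : ℝ) - mf x) ^ 2) /
          ((shell M.2.partner t (2 * j + 1)).card : ℝ)))
      (fun j : ℕ => ((∑ U ∈ ((shell M.2.partner t (2 * j + 1)).filter fun U => ((U ∩ H).card : ℤ) = x),
          (((((reps M.2.partner (vAA M.2.partner univ H)).filter fun v => v ∈ U ∧ M.2.partner v ∈ U).card : ℕ) : ℝ) - mf x)) /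
          ((shell M.2.partner t (2 * j + 1)).card : ℝ)))
      (fun j : ℕ => shellLaw M.2.partner univ H t (2 * j + 1) x)
      (2 * gam) (2 * lam * (x : ℝ) + kap * (t : ℝ) + 2 * gam * mf x) εA εB εC
      (by simp only [mul_zero, zero_add]; exact div_nonneg (sum_nonneg fun _ _ => sq_nonneg _) (Nat.cast_nonneg _))
      (by simp only [mul_zero, zero_add]; exact shellLaw_nonneg' _ _ _ _ _)
      (by simp only [mul_zero, zero_add]; exact hcentre x hx) hεB h1 h2
      (by simp only [mul_zero, zero_add]; exact hA x hx)
      (by simp only [mul_zero, zero_add]; exact hBm x hx)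
      (by simp only [mul_zero, zero_add]; exact hC x hx)
    simp only [mul_zero, zero_add] at key
    exact key
  have hmain := gammaProfile_newton_eval_zero_ge D t M H ψ hψ0 hψG gam lam kap B hB hbulk
  refine le_trans ?_ hmain
  -- compare the tails: `Q ≤ (2n+3t)²·law`
  apply neg_le_neg
  calc _ ≤ (2 : ℝ) ^ (D + 1) * G * ∑ x ∈ Icc (0 : ℤ) t \ B, ∑ j ∈ range (D + 1),
        ((2 * (n : ℝ) + 3 * (t : ℝ)) ^ 2 * shellLaw M.2.partner univ H t (2 * j + 1) x) := by
        gcongr with x hx j _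
        exact gammaSection_le_law t M H hgam hlam hkap (2 * j + 1) (mem_sdiff.1 hx).1
    _ = _ := by simp only [← mul_sum]; ring

end Summit.PneNP.PneNP.Theorems.ChebyshevTracialDesignGammaDirectionCriterion

end
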